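import Summits.CriticalPhenomena.CardyFormulaZ2.Theorems.CardyBoundaryCoulombGasHalfPlaneMarkDensityLawFromRectilinear
import Summits.CriticalPhenomena.CardyFormulaZ2.Theorems.CardyBoundaryCoulombGasHalfPlaneMarkDensityLawConverse
import Summits.CriticalPhenomena.CardyFormulaZ2.Theorems.CardyBoundaryCoulombGasAssembly

/-!
# Line `Sketch` — the logical position of the crux `HalfPlaneMarkDensityLaw` (stmt-CriticalPhenomena-5661):
# it is NECESSARY for the conjunct `CardyFormulaZ2`

`RectilinearCardy` (stmt-5660) is the rectilinear special case of the conjunct, and the conjunct follows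
from it by the proved support `RectilinearSuffices` (`RectilinearSuffices_proof`); so crux 4 of route
CardyBoundaryCoulombGas is EQUIVALENT to the conjunct, and crux 5 (`HalfPlaneMarkDensityLaw`, equivalently
the collinear half-plane Cardy law C⁺, `stub_equivalence`) follows from the conjunct
(`stub_fromRectilinear`).  Consequences recorded for planners / refuters: a refutation of crux 5 (or of
C⁺) refutes `CardyFormulaZ2` itself; no line for crux 5 can avoid a statement of half-plane-Cardy
strength; the one open stub `stub_collinearCardy` of line `Sketch` is implied by the summit conjunct.
-/

noncomputable section

namespace Summit.CriticalPhenomena.CardyFormulaZ2.Cruxes.HalfPlaneMarkDensityLaw.SketchLine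

open Literature.Probability.Percolation Literature.Probability.LatticeModels
open MeasureTheory Filter Set
open scoped Topology
open Summit.CriticalPhenomena.CardyFormulaZ2.Theses.CardyBoundaryCoulombGas
  (HalfPlaneMarkDensityLaw RectilinearCardy)
open Summit.CriticalPhenomena.CardyFormulaZ2.Theorems.HalfPlaneMarkDensityLaw.Negative

/-- The conjunct specialises to rectilinear conformal rectangles: `CardyFormulaZ2 → RectilinearCardy`.
[folklore] -/
theorem rectilinearCardy_of_cardyFormulaZ2 : _root_.CardyFormulaZ2 → RectilinearCardy :=
  fun h R _ ↦ h R

/-- **Crux 4 is the conjunct**: `RectilinearCardy ↔ CardyFormulaZ2` (`←` specialisation, `→` the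
proved support `RectilinearSuffices`). [folklore] -/
theorem rectilinearCardy_iff_cardyFormulaZ2 : RectilinearCardy ↔ _root_.CardyFormulaZ2 :=
  ⟨fun h ↦ Summit.CriticalPhenomena.CardyFormulaZ2.Theorems.RectilinearSuffices_proof h,
    rectilinearCardy_of_cardyFormulaZ2⟩

/-- **Crux 5 is necessary for the conjunct**: `CardyFormulaZ2 → HalfPlaneMarkDensityLaw`. [folklore] -/
theorem halfPlaneMarkDensityLaw_of_cardyFormulaZ2 : _root_.CardyFormulaZ2 → HalfPlaneMarkDensityLaw :=
  fun h ↦ stub_fromRectilinear (rectilinearCardy_of_cardyFormulaZ2 h)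

/-- **C⁺ is necessary for the conjunct**: the collinear half-plane Cardy law for bond-`ℤ²` (the one
open stub `stub_collinearCardy` of line `Sketch`) follows from `CardyFormulaZ2`. [folklore] -/
theorem collinearCardy_of_cardyFormulaZ2 : _root_.CardyFormulaZ2 →
    ∀ a b c y : ℝ, a < b → b < c → c < y →
      Tendsto (fun n : ℕ ↦ μ.real (openCrossing halfPlane (arcA a b n) (rowIcc ⌊c * n⌋ ⌊y * n⌋))) atTop
        (𝓝 (Literature.Probability.RandomPlanarGeometry.cardyFunction
          (Literature.Probability.RandomPlanarGeometry.crossRatio ![a, b, c, y]))) :=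
  fun h ↦ collinearCardy_of_rectilinearCardy (rectilinearCardy_of_cardyFormulaZ2 h)

/-- **The implication diagram of crux 5, closed up**: `HalfPlaneMarkDensityLaw`, C⁺ are equivalent;
`RectilinearCardy`, `CardyFormulaZ2` are equivalent; and the latter pair implies the former. [folklore] -/
theorem cruxFive_position :
    (HalfPlaneMarkDensityLaw ↔ ∀ a b c y : ℝ, a < b → b < c → c < y →
      Tendsto (fun n : ℕ ↦ μ.real (openCrossing halfPlane (arcA a b n) (rowIcc ⌊c * n⌋ ⌊y * n⌋))) atTop
        (𝓝 (Literature.Probability.RandomPlanarGeometry.cardyFunction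
          (Literature.Probability.RandomPlanarGeometry.crossRatio ![a, b, c, y])))) ∧
    (RectilinearCardy ↔ _root_.CardyFormulaZ2) ∧ (_root_.CardyFormulaZ2 → HalfPlaneMarkDensityLaw) :=
  ⟨⟨stub_converse, stub_reduction⟩, rectilinearCardy_iff_cardyFormulaZ2, halfPlaneMarkDensityLaw_of_cardyFormulaZ2⟩

end Summit.CriticalPhenomena.CardyFormulaZ2.Cruxes.HalfPlaneMarkDensityLaw.SketchLine
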